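import Mathlib
import HarnessLib
import Summits.QuantumFields.YangMills.Theses.LangevinControlUV

/-!
# Sketch (crux-ideate, ideator 2, round 1) — first-lemma signatures for crux
`FemtoCurvatureTwoPoint` (stmt-QuantumFields-9363)

Cards: `deep-band-gaussian-regime` (C⁺ = `DeepBandTwoPoint`, transfer `crux_of_deepBand`
— PROVED here, sorry-free — and first lemma `PlaquetteTailBound`) and
`witten-laplacian-tangent-process` (first lemma `DeepBandPlaquetteVariance`).
Only the transfer is proved; the other declarations are signatures (`def … : Prop`).
-/

open scoped BigOperators
open MeasureTheory Filter Topology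

namespace Summit.QuantumFields.YangMills.Cruxes.FemtoCurvatureTwoPoint.Ideator2

open Literature.MathematicalPhysics.QuantumFieldTheory

/-- **C⁺ (deep band / frozen coupling).** For every compact simple `G` and faithful unitary `r`
there are `M, β₀, c, C` with `M, c > 0` such that on EVERY periodic torus `(ℤ/L)⁴` with
`log L ≤ β/M` and `β ≥ β₀` (sub-exponential volume: no coupling renormalisation,
`∑_j g_j² ≤ C/M`), the plaquette covariances are Gaussian-sized two-sidedly in BARE units:
`c ≤ β² (n⁸ Cov(P₀^{01}, P_{ne₂}^{01})) ≤ C` for `1 ≤ n ≤ L/8`, and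
`β² |Cov(P_x^{ij}, P_y^{i'j'})| dist(x,y)⁸ ≤ C` for `x ≠ y`.
No unit map, no shape function, no `Λ`-parameter: a convention-free weak-coupling theorem. -/
def DeepBandTwoPoint : Prop :=
  ∀ (G : Type) [Group G] [TopologicalSpace G] [IsTopologicalGroup G] [CompactSpace G],
    IsCompactSimpleLieGroup G →
    letI : MeasurableSpace G := borel G
    haveI : BorelSpace G := ⟨rfl⟩
    ∀ (r : LatticeRep G), ∃ (M β₀ c C : ℝ), 0 < M ∧ 0 < c ∧
      ∀ (L : ℕ) [NeZero L] (β : ℝ), β₀ ≤ β → Real.log (L : ℝ) ≤ β / M →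
        let P : (Fin 4 → ZMod L) → Fin 4 → Fin 4 → GaugeConfig 4 L G → ℝ :=
          fun x i j U => (r.N : ℝ) - (r.ρ (plaquetteHolonomy U x i j)).trace.re
        let E : (GaugeConfig 4 L G → ℝ) → ℝ := fun F => wilsonExpectation (d := 4) (L := L) r.ρ β F
        let cov : (GaugeConfig 4 L G → ℝ) → (GaugeConfig 4 L G → ℝ) → ℝ :=
          fun F F' => E (fun U => F U * F' U) - E F * E F'
        let dist : (Fin 4 → ZMod L) → (Fin 4 → ZMod L) → ℝ :=
          fun x y => Real.sqrt (∑ k : Fin 4, (((x k - y k).valMinAbs : ℤ) : ℝ) ^ 2)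
        (∀ n : ℕ, 1 ≤ n → 8 * n ≤ L →
            c ≤ β ^ 2 * ((n : ℝ) ^ 8 * cov (P 0 0 1) (P (Pi.single (2 : Fin 4) ((n : ℕ) : ZMod L)) 0 1)) ∧
            β ^ 2 * ((n : ℝ) ^ 8 * cov (P 0 0 1) (P (Pi.single (2 : Fin 4) ((n : ℕ) : ZMod L)) 0 1)) ≤ C) ∧
        (∀ (x y : Fin 4 → ZMod L) (i j i' j' : Fin 4), x ≠ y → i ≠ j → i' ≠ j' →
            β ^ 2 * (|cov (P x i j) (P y i' j')| * dist x y ^ 8) ≤ C)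

/-! ### The generic-step encoding, proved (pure real analysis) -/

/-- Step index `k(β) = ⌊log₂ ⌊β⌋₊⌋`, so that `2^k ≤ β < 2^{k+1}` for `β ≥ 1`. -/
noncomputable def stepIdx (β : ℝ) : ℕ := Nat.log 2 ⌊β⌋₊

/-- The step unit map `a(β) = e^{-2^{k(β)}/M'}`. -/
noncomputable def aEnc (M' β : ℝ) : ℝ := Real.exp (-(2 : ℝ) ^ stepIdx β / M')

open Classical in
/-- The encoded shape: `Γ(√m · e^{-2^k/M'}) = 4^{-k}` on the level sets (`m ≥ 1`), `Γ = 1`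
elsewhere; well defined once the level sets of distinct steps are disjoint (genericity of `M'`). -/
noncomputable def gammaEnc (M' s : ℝ) : ℝ :=
  if h : ∃ k m : ℕ, 1 ≤ m ∧ s = Real.sqrt m * Real.exp (-(2 : ℝ) ^ k / M')
    then ((4 : ℝ) ^ (Classical.choose h))⁻¹ else 1

theorem two_pow_stepIdx_le {β : ℝ} (hβ : 1 ≤ β) : (2 : ℝ) ^ stepIdx β ≤ β := by
  have hfl : ⌊β⌋₊ ≠ 0 := (Nat.floor_pos.2 hβ).ne'
  have h1 : 2 ^ Nat.log 2 ⌊β⌋₊ ≤ ⌊β⌋₊ := Nat.pow_log_le_self 2 hfl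
  have h2 : ((2 ^ Nat.log 2 ⌊β⌋₊ : ℕ) : ℝ) ≤ (⌊β⌋₊ : ℝ) := by exact_mod_cast h1
  have h3 : (⌊β⌋₊ : ℝ) ≤ β := Nat.floor_le (by linarith)
  have h4 : ((2 ^ Nat.log 2 ⌊β⌋₊ : ℕ) : ℝ) = (2 : ℝ) ^ stepIdx β := by
    rw [stepIdx]; push_cast; ring
  rw [← h4]
  exact h2.trans h3

theorem lt_two_pow_stepIdx_succ (β : ℝ) : β < (2 : ℝ) ^ (stepIdx β + 1) := by
  have h1 : ⌊β⌋₊ < 2 ^ (Nat.log 2 ⌊β⌋₊ + 1) := Nat.lt_pow_succ_log_self (by norm_num) ⌊β⌋₊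
  have h2 : ⌊β⌋₊ + 1 ≤ 2 ^ (Nat.log 2 ⌊β⌋₊ + 1) := h1
  have h3 : ((⌊β⌋₊ + 1 : ℕ) : ℝ) ≤ ((2 ^ (Nat.log 2 ⌊β⌋₊ + 1) : ℕ) : ℝ) := by exact_mod_cast h2
  have h4 : β < (⌊β⌋₊ : ℝ) + 1 := Nat.lt_floor_add_one β
  calc β < (⌊β⌋₊ : ℝ) + 1 := h4
    _ = ((⌊β⌋₊ + 1 : ℕ) : ℝ) := by push_cast; ring
    _ ≤ ((2 ^ (Nat.log 2 ⌊β⌋₊ + 1) : ℕ) : ℝ) := h3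
    _ = (2 : ℝ) ^ (stepIdx β + 1) := by rw [stepIdx]; push_cast; ring

theorem aEnc_pos (M' β : ℝ) : 0 < aEnc M' β := Real.exp_pos _

theorem tendsto_aEnc {M' : ℝ} (hM' : 0 < M') : Tendsto (aEnc M') atTop (𝓝 0) := by
  have h1 : Tendsto (fun β : ℝ => -β * (1 / (2 * M'))) atTop atBot :=
    tendsto_neg_atTop_atBot.atBot_mul_const (by positivity)
  have h2 : Tendsto (fun β : ℝ => Real.exp (-β * (1 / (2 * M')))) atTop (𝓝 0) :=
    Real.tendsto_exp_atBot.comp h1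
  refine tendsto_of_tendsto_of_tendsto_of_le_of_le tendsto_const_nhds h2
    (fun β => (aEnc_pos M' β).le) fun β => ?_
  show Real.exp (-(2 : ℝ) ^ stepIdx β / M') ≤ Real.exp (-β * (1 / (2 * M')))
  apply Real.exp_le_exp.2
  have hlt := lt_two_pow_stepIdx_succ β
  rw [pow_succ] at hlt
  have hk : β ≤ 2 * (2 : ℝ) ^ stepIdx β := by linarith
  have e : -(2 : ℝ) ^ stepIdx β / M' = -(2 * (2 : ℝ) ^ stepIdx β) * (1 / (2 * M')) := by
    ring
  rw [e]
  exact mul_le_mul_of_nonneg_right (by linarith) (by positivity)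

theorem gammaEnc_pos (M' s : ℝ) : 0 < gammaEnc M' s := by
  unfold gammaEnc; split_ifs <;> positivity

theorem gammaEnc_le_one (M' s : ℝ) : gammaEnc M' s ≤ 1 := by
  unfold gammaEnc
  split_ifs
  · exact inv_le_one_of_one_le₀ (one_le_pow₀ (by norm_num))
  · exact le_rfl

/-- On a level set `s = √m · e^{-2^k/M'}` the encoded shape is `4^{-k}`, provided the level sets
of distinct steps are disjoint. -/
theorem gammaEnc_eq {M' : ℝ}
    (hgen : ∀ (k k' m m' : ℕ), k ≠ k' → 1 ≤ m → 1 ≤ m' →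
      Real.sqrt m * Real.exp (-(2 : ℝ) ^ k / M') ≠ Real.sqrt m' * Real.exp (-(2 : ℝ) ^ k' / M'))
    (k m : ℕ) (hm : 1 ≤ m) :
    gammaEnc M' (Real.sqrt m * Real.exp (-(2 : ℝ) ^ k / M')) = ((4 : ℝ) ^ k)⁻¹ := by
  have h : ∃ k' m' : ℕ, 1 ≤ m' ∧ Real.sqrt m * Real.exp (-(2 : ℝ) ^ k / M') =
      Real.sqrt m' * Real.exp (-(2 : ℝ) ^ k' / M') := ⟨k, m, hm, rfl⟩
  unfold gammaEnc
  rw [dif_pos h]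
  obtain ⟨m', hm', heq⟩ := Classical.choose_spec h
  have hk : Classical.choose h = k := by
    by_contra hne
    exact hgen k (Classical.choose h) m m' (Ne.symm hne) hm hm' heq
  rw [hk]

/-- **Genericity of the band parameter.** For `M > 0` there is `M' ≥ M` such that the level
sets `{√m · e^{-2^k/M'} : m ≥ 1}` of distinct steps `k ≠ k'` are disjoint: the bad `M'` form a
countable set (one value per `(k, k', m, m')`), and `[M, M+1]` has positive Lebesgue measure. -/
theorem exists_generic {M : ℝ} (hM : 0 < M) :
    ∃ M' : ℝ, M ≤ M' ∧ ∀ (k k' m m' : ℕ), k ≠ k' → 1 ≤ m → 1 ≤ m' →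
      Real.sqrt m * Real.exp (-(2 : ℝ) ^ k / M') ≠ Real.sqrt m' * Real.exp (-(2 : ℝ) ^ k' / M') := by
  classical
  let B : Set ℝ := ⋃ k : ℕ, ⋃ k' : ℕ, ⋃ m : ℕ, ⋃ m' : ℕ,
    {t : ℝ | k ≠ k' ∧ 1 ≤ m ∧ 1 ≤ m' ∧ t ≠ 0 ∧
      Real.sqrt m * Real.exp (-(2 : ℝ) ^ k / t) = Real.sqrt m' * Real.exp (-(2 : ℝ) ^ k' / t)}
  have key : ∀ (k k' m m' : ℕ) (s : ℝ), 1 ≤ m → 1 ≤ m' → s ≠ 0 →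
      Real.sqrt m * Real.exp (-(2 : ℝ) ^ k / s) = Real.sqrt m' * Real.exp (-(2 : ℝ) ^ k' / s) →
      ((2 : ℝ) ^ k' - (2 : ℝ) ^ k) / s = Real.log (Real.sqrt m' / Real.sqrt m) := by
    intro k k' m m' s hm hm' hs h
    have hm0 : 0 < Real.sqrt m := Real.sqrt_pos.2 (by exact_mod_cast hm)
    have hm0' : 0 < Real.sqrt m' := Real.sqrt_pos.2 (by exact_mod_cast hm')
    have hexp : Real.exp (((2 : ℝ) ^ k' - (2 : ℝ) ^ k) / s) = Real.sqrt m' / Real.sqrt m := by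
      have e1 : ((2 : ℝ) ^ k' - (2 : ℝ) ^ k) / s = (-(2 : ℝ) ^ k / s) - (-(2 : ℝ) ^ k' / s) := by
        ring
      rw [e1, Real.exp_sub, div_eq_div_iff (Real.exp_pos _).ne' hm0.ne', mul_comm]
      exact h
    have hl := congrArg Real.log hexp
    rwa [Real.log_exp] at hl
  have hcount : B.Countable := by
    refine Set.countable_iUnion fun k => Set.countable_iUnion fun k' =>
      Set.countable_iUnion fun m => Set.countable_iUnion fun m' => Set.Subsingleton.countable ?_
    intro t ht u hu
    obtain ⟨hkk, hm, hm', ht0, hteq⟩ := ht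
    obtain ⟨-, -, -, hu0, hueq⟩ := hu
    have e1 := key k k' m m' t hm hm' ht0 hteq
    have e2 := key k k' m m' u hm hm' hu0 hueq
    have hD : (2 : ℝ) ^ k' - (2 : ℝ) ^ k ≠ 0 := by
      intro h0
      have h1 : (2 : ℝ) ^ k' = (2 : ℝ) ^ k := by linarith
      have h2 : (2 : ℕ) ^ k' = 2 ^ k := by exact_mod_cast h1
      exact hkk (Nat.pow_right_injective le_rfl h2).symm
    have e3 : ((2 : ℝ) ^ k' - (2 : ℝ) ^ k) / t = ((2 : ℝ) ^ k' - (2 : ℝ) ^ k) / u := by rw [e1, e2]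
    rw [div_eq_div_iff ht0 hu0] at e3
    exact (mul_left_cancel₀ hD e3).symm
  have hB0 : volume B = 0 := hcount.measure_zero volume
  have hIcc : volume (Set.Icc M (M + 1)) ≠ 0 := by
    rw [Real.volume_Icc]; simp
  have hns : ¬ Set.Icc M (M + 1) ⊆ B := fun hsub => hIcc (measure_mono_null hsub hB0)
  obtain ⟨M', hM'I, hM'B⟩ := Set.not_subset.1 hns
  refine ⟨M', hM'I.1, fun k k' m m' hkk hm hm' heq => hM'B ?_⟩
  have hM'0 : M' ≠ 0 := by
    have : 0 < M' := hM.trans_le hM'I.1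
    exact this.ne'
  simp only [B, Set.mem_iUnion, Set.mem_setOf_eq]
  exact ⟨k, k', m, m', hkk, hm, hm', hM'0, heq⟩

/-- Arithmetic of one step: `2^k ≤ β < 2^{k+1}` turns `[c, C]·β⁻²` into `[(c/4)4^{-k}, |C|4^{-k}]`. -/
theorem band_to_levels {β c C Y : ℝ} {k : ℕ} (h2k : (2 : ℝ) ^ k ≤ β) (hβlt : β < (2 : ℝ) ^ (k + 1))
    (hc : 0 < c) (h_lo : c ≤ β ^ 2 * Y) (h_hi : β ^ 2 * Y ≤ C) :
    c / 4 * ((4 : ℝ) ^ k)⁻¹ ≤ Y ∧ Y ≤ |C| * ((4 : ℝ) ^ k)⁻¹ := by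
  have h2kpos : 0 < (2 : ℝ) ^ k := by positivity
  have hβpos : 0 < β := h2kpos.trans_le h2k
  have hβ2 : 0 < β ^ 2 := by positivity
  have h4k : (4 : ℝ) ^ k = ((2 : ℝ) ^ k) ^ 2 := by
    rw [show (4 : ℝ) = 2 ^ 2 by norm_num, ← pow_mul, mul_comm, pow_mul]
  have h4k1 : (4 : ℝ) ^ (k + 1) = ((2 : ℝ) ^ (k + 1)) ^ 2 := by
    rw [show (4 : ℝ) = 2 ^ 2 by norm_num, ← pow_mul, mul_comm, pow_mul]
  have hle : (4 : ℝ) ^ k ≤ β ^ 2 := by rw [h4k]; exact pow_le_pow_left₀ h2kpos.le h2k 2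
  have hlt : β ^ 2 ≤ (4 : ℝ) ^ (k + 1) := by
    rw [h4k1]; exact (pow_lt_pow_left₀ hβlt hβpos.le two_ne_zero).le
  have h4pos : 0 < (4 : ℝ) ^ k := by positivity
  constructor
  · have hY : c / β ^ 2 ≤ Y := by rw [div_le_iff₀ hβ2]; linarith
    have h1 : c / (4 : ℝ) ^ (k + 1) ≤ c / β ^ 2 := div_le_div_of_nonneg_left hc.le hβ2 hlt
    have h2 : c / 4 * ((4 : ℝ) ^ k)⁻¹ = c / (4 : ℝ) ^ (k + 1) := by rw [pow_succ]; field_simp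
    rw [h2]; exact h1.trans hY
  · have hY : Y ≤ C / β ^ 2 := by rw [le_div_iff₀ hβ2]; linarith
    have h1 : C / β ^ 2 ≤ |C| / β ^ 2 := div_le_div_of_nonneg_right (le_abs_self C) hβ2.le
    have h2 : |C| / β ^ 2 ≤ |C| / (4 : ℝ) ^ k := div_le_div_of_nonneg_left (abs_nonneg C) h4pos hle
    rw [← div_eq_mul_inv]
    exact hY.trans (h1.trans h2)

theorem allpairs_to_levels {β C Y : ℝ} {k : ℕ} (h2k : (2 : ℝ) ^ k ≤ β) (_hY : 0 ≤ Y)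
    (h : β ^ 2 * Y ≤ C) : Y ≤ |C| * ((4 : ℝ) ^ k)⁻¹ := by
  have h2kpos : 0 < (2 : ℝ) ^ k := by positivity
  have hβpos : 0 < β := h2kpos.trans_le h2k
  have hβ2 : 0 < β ^ 2 := by positivity
  have h4k : (4 : ℝ) ^ k = ((2 : ℝ) ^ k) ^ 2 := by
    rw [show (4 : ℝ) = 2 ^ 2 by norm_num, ← pow_mul, mul_comm, pow_mul]
  have hle : (4 : ℝ) ^ k ≤ β ^ 2 := by rw [h4k]; exact pow_le_pow_left₀ h2kpos.le h2k 2
  have h4pos : 0 < (4 : ℝ) ^ k := by positivity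
  have h0 : Y ≤ C / β ^ 2 := by rw [le_div_iff₀ hβ2]; linarith
  have h1 : C / β ^ 2 ≤ |C| / β ^ 2 := div_le_div_of_nonneg_right (le_abs_self C) hβ2.le
  have h2 : |C| / β ^ 2 ≤ |C| / (4 : ℝ) ^ k := div_le_div_of_nonneg_left (abs_nonneg C) h4pos hle
  rw [← div_eq_mul_inv]
  exact h0.trans (h1.trans h2)

/-- Torus distances are square roots of positive integers. -/
theorem dist_eq_sqrt_nat {L : ℕ} (x y : Fin 4 → ZMod L) (hxy : x ≠ y) :
    ∃ m : ℕ, 1 ≤ m ∧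
      Real.sqrt (∑ k : Fin 4, (((x k - y k).valMinAbs : ℤ) : ℝ) ^ 2) = Real.sqrt (m : ℝ) := by
  refine ⟨∑ k : Fin 4, ((x k - y k).valMinAbs.natAbs) ^ 2, ?_, ?_⟩
  · obtain ⟨k, hk⟩ := Function.ne_iff.1 hxy
    have hne : (x k - y k).valMinAbs ≠ 0 := by
      rw [Ne, ZMod.valMinAbs_eq_zero, sub_eq_zero]; exact hk
    have h1 : 1 ≤ (x k - y k).valMinAbs.natAbs ^ 2 := by
      have : 1 ≤ (x k - y k).valMinAbs.natAbs := Nat.one_le_iff_ne_zero.2 (Int.natAbs_ne_zero.2 hne)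
      nlinarith
    exact h1.trans (Finset.single_le_sum (f := fun i => ((x i - y i).valMinAbs.natAbs) ^ 2)
      (fun i _ => Nat.zero_le _) (Finset.mem_univ k))
  · congr 1
    push_cast
    refine Finset.sum_congr rfl fun k _ => ?_
    rw [Nat.cast_natAbs, Int.cast_abs, sq_abs]

/-- **Transfer (proved).** `C⁺ ⇒ crux`: a generic step unit map `a(β) = e^{-2^{k(β)}/M'}` with
`M' ≥ M` generic puts every femto torus (`L·a(β) ≤ 1`) in the band `log L ≤ β/M`, and the level
sets `√m · a_k` of distinct steps are disjoint, so `Γ(√m · a_k) := 4^{-k}` (else `1`) serves both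
clauses: `2^k ≤ β < 2^{k+1}` turns `[c, C]·β⁻²` into `[(c/4)Γ, |C|Γ]`. (The encoding step is the one
of card `generic-step-gamma-encoding`; what is new is the band it is applied to.) -/
theorem crux_of_deepBand :
    DeepBandTwoPoint → Summit.QuantumFields.YangMills.Theses.LangevinControlUV.FemtoCurvatureTwoPoint := by
  intro hC G _ _ _ _ hG r
  obtain ⟨M, β₀, c, C, hM, hc, H⟩ := hC G hG r
  obtain ⟨M', hMM', hgen⟩ := exists_generic hM
  have hM' : 0 < M' := hM.trans_le hMM'
  refine ⟨aEnc M', gammaEnc M', max β₀ 1, 1, c / 4, |C|, one_pos, by positivity,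
    fun β => aEnc_pos M' β, tendsto_aEnc hM',
    fun s _ _ => ⟨gammaEnc_pos M' s, gammaEnc_le_one M' s⟩, ?_⟩
  intro L _ β hβ hLa
  have hβ0 : β₀ ≤ β := (le_max_left _ _).trans hβ
  have hβ1 : 1 ≤ β := (le_max_right _ _).trans hβ
  have h2k : (2 : ℝ) ^ stepIdx β ≤ β := two_pow_stepIdx_le hβ1
  have hβlt : β < (2 : ℝ) ^ (stepIdx β + 1) := lt_two_pow_stepIdx_succ β
  have hβpos : 0 < β := by linarith
  have hL0 : (0 : ℝ) < L := Nat.cast_pos.2 (Nat.pos_of_ne_zero (NeZero.ne L))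
  -- femto ⇒ band
  have hlog : Real.log (L : ℝ) ≤ β / M := by
    have ha : (L : ℝ) * Real.exp (-(2 : ℝ) ^ stepIdx β / M') ≤ 1 := hLa
    have h1 : (L : ℝ) ≤ Real.exp ((2 : ℝ) ^ stepIdx β / M') := by
      calc (L : ℝ) = (L : ℝ) * Real.exp (-(2 : ℝ) ^ stepIdx β / M') *
            Real.exp ((2 : ℝ) ^ stepIdx β / M') := by
              rw [mul_assoc, ← Real.exp_add, neg_div, neg_add_cancel, Real.exp_zero, mul_one]
        _ ≤ 1 * Real.exp ((2 : ℝ) ^ stepIdx β / M') := by gcongr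
        _ = Real.exp ((2 : ℝ) ^ stepIdx β / M') := one_mul _
    have h2 : Real.log (L : ℝ) ≤ (2 : ℝ) ^ stepIdx β / M' := (Real.log_le_iff_le_exp hL0).2 h1
    have h3 : (2 : ℝ) ^ stepIdx β / M' ≤ β / M' := div_le_div_of_nonneg_right h2k hM'.le
    have h4 : β / M' ≤ β / M := div_le_div_of_nonneg_left hβpos.le hM hMM'
    linarith
  have HH := H L β hβ0 hlog
  obtain ⟨hax, hall⟩ := HH
  refine ⟨fun n hn h8 => ?_, fun x y i j i' j' hxy hij hij' => ?_⟩
  · obtain ⟨h_lo, h_hi⟩ := hax n hn h8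
    have hΓ : gammaEnc M' ((n : ℝ) * aEnc M' β) = ((4 : ℝ) ^ stepIdx β)⁻¹ := by
      have e : (n : ℝ) * aEnc M' β =
          Real.sqrt ((n ^ 2 : ℕ) : ℝ) * Real.exp (-(2 : ℝ) ^ stepIdx β / M') := by
        rw [show aEnc M' β = Real.exp (-(2 : ℝ) ^ stepIdx β / M') from rfl]
        congr 1
        push_cast
        rw [Real.sqrt_sq (Nat.cast_nonneg n)]
      rw [e]
      exact gammaEnc_eq hgen (stepIdx β) (n ^ 2) (by nlinarith)
    rw [hΓ]
    exact band_to_levels h2k hβlt hc h_lo h_hi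
  · have hxy' := hall x y i j i' j' hxy hij hij'
    obtain ⟨m, hm, hdist⟩ := dist_eq_sqrt_nat x y hxy
    dsimp only at hxy' ⊢
    rw [hdist] at hxy' ⊢
    have hΓ : gammaEnc M' (Real.sqrt (m : ℝ) * aEnc M' β) = ((4 : ℝ) ^ stepIdx β)⁻¹ :=
      gammaEnc_eq hgen (stepIdx β) m hm
    rw [hΓ]
    exact allpairs_to_levels h2k (by positivity) hxy'

/-- **First lemma of `deep-band-gaussian-regime` (chessboard large-field tail, provable from
tree RP).** For every `δ > 0` the probability that a given plaquette has `P ≥ δ` is `≤ K e^{-cβ}`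
UNIFORMLY in the (even) torus size: reflection positivity in all four directions (site planes in
the plaquette's own directions, link planes in the transverse ones) ⇒ chessboard estimate
`μ(P_p ≥ δ) ≤ (Z_{all bad}/Z)^{1/L⁴}`, and `Z ≥ e^{-6βεL⁴}·Haar(all links ε-close to 1)`,
`Z_bad ≤ e^{-βδL⁴}` give `K = K(δ, G, r)`, `c = δ/2`. Union bound over `6L⁴` plaquettes then
deletes order-one fields on every torus of the deep band `log L ≤ β/M` once `cM > 4`. -/
def PlaquetteTailBound : Prop :=
  ∀ (G : Type) [Group G] [TopologicalSpace G] [IsTopologicalGroup G] [CompactSpace G],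
    IsCompactSimpleLieGroup G →
    letI : MeasurableSpace G := borel G
    haveI : BorelSpace G := ⟨rfl⟩
    ∀ (r : LatticeRep G) (δ : ℝ), 0 < δ → ∃ (c K : ℝ), 0 < c ∧
      ∀ (L : ℕ) [NeZero L] (β : ℝ), Even L → 0 ≤ β →
        ∀ (x : Fin 4 → ZMod L) (i j : Fin 4), i ≠ j →
          wilsonExpectation (d := 4) (L := L) r.ρ β
              (fun U => if δ ≤ (r.N : ℝ) - (r.ρ (plaquetteHolonomy U x i j)).trace.re then (1 : ℝ) else 0)
            ≤ K * Real.exp (-(c * β))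

/-- **First lemma of `witten-laplacian-tangent-process` (the `n = 0` rung).** In the deep band the
plaquette VARIANCE is Gaussian-sized two-sidedly, `c ≤ β² Var(P_x^{ij}) ≤ C` uniformly in `L`
(tree level `3/8` for `SU(2)`): the Helffer–Sjöstrand identity
`Var(P) = ∫⟨dP, (Δ¹_{βS})⁻¹ dP⟩ dμ` with `|dP| ≍ |F| ≍ β^{-1/2}` and `(Δ¹)⁻¹ ≍ (β d*d)⁻¹` on local
horizontal 1-forms is the engine's first test (upper bound = annealed tangent contraction, lower
bound = Cramér–Rao pairing against `v = ∇P`). Not contained in `DeepBandTwoPoint` (which has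
`x ≠ y`, `n ≥ 1`). -/
def DeepBandPlaquetteVariance : Prop :=
  ∀ (G : Type) [Group G] [TopologicalSpace G] [IsTopologicalGroup G] [CompactSpace G],
    IsCompactSimpleLieGroup G →
    letI : MeasurableSpace G := borel G
    haveI : BorelSpace G := ⟨rfl⟩
    ∀ (r : LatticeRep G), ∃ (M β₀ c C : ℝ), 0 < M ∧ 0 < c ∧
      ∀ (L : ℕ) [NeZero L] (β : ℝ), β₀ ≤ β → Real.log (L : ℝ) ≤ β / M →
        ∀ (x : Fin 4 → ZMod L) (i j : Fin 4), i ≠ j →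
          let P : GaugeConfig 4 L G → ℝ := fun U => (r.N : ℝ) - (r.ρ (plaquetteHolonomy U x i j)).trace.re
          let E : (GaugeConfig 4 L G → ℝ) → ℝ := fun F => wilsonExpectation (d := 4) (L := L) r.ρ β F
          c ≤ β ^ 2 * (E (fun U => P U * P U) - E P * E P) ∧
            β ^ 2 * (E (fun U => P U * P U) - E P * E P) ≤ C

end Summit.QuantumFields.YangMills.Cruxes.FemtoCurvatureTwoPoint.Ideator2
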